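/-
PORT (pub-hodgecm2, COR-CM cell), part 2/2 of the stage-1 package file `HodgeCMPerL/HodgeCM/CM/LefschetzChar.lean`
(md5 1530b8b90fc9, 435 lines; split mechanically at top-level declaration boundaries because tree files are
≤ 400 lines; the enclosing namespaces/sections/variables are re-opened verbatim). Declarations VERBATIM; edits as in part 1.
-/
import Summits.HodgeConjecture.CorCM.CM.LefschetzChar1

/-!
# `CM/LefschetzChar.lean` — part 2/2 (continued)

Continuation of `Summits.HodgeConjecture.CorCM.CM.LefschetzChar1`: the stage-1 package file `HodgeCM/CM/LefschetzChar.lean` is split mechanically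
at top-level declaration boundaries (tree files are ≤ 400 lines); the enclosing namespaces, sections,
`variable`s and local notation are re-opened exactly as they stand at the cut. See part 1 for the
mathematical module docstring.
-/

noncomputable section

open NumberField NumberField.ComplexEmbedding
open scoped symmDiff


namespace Summit.HodgeConjecture.CorCM

open Literature.AlgebraicGeometry.Motives (CMType)
open Literature.NumberTheory.ComplexMultiplication.CMTypeOps
open Summit.HodgeConjecture.CorCM.Prior.AllgGroup.RfwfAllgGroup


section Main

variable {F : Type} [Field F] [NumberField F]

attribute [local instance] Classical.propDecidable

variable [IsGalois ℚ F]


/-- Pulling back the type flipped at the place of `t σ₀` is the abstract flip `oflipCM` by `t` of the pulled-back type. -/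
theorem pullType_flip (Θ : CMType F) (σ₀ : F →+* ℂ) (t : GalT F) :
    pullType (flip (t.1 σ₀) Θ) σ₀ = oflipCM conjT conjT_mul_self t (pullType Θ σ₀) := by
  apply Subtype.ext
  ext P
  rw [mem_pullType, mem_flip_iff]
  change _ ↔ P ∈ (pullType Θ σ₀).1 ∆ orb conjT t
  rw [Finset.mem_symmDiff, mem_pullType, mem_orb]
  have hplace : P.1 σ₀ ∈ placeSet (t.1 σ₀) ↔ (P = t ∨ P = conjT * t) := by
    simp only [placeSet, Set.mem_insert_iff, Set.mem_singleton_iff]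
    constructor
    · rintro (h | h)
      · exact Or.inl (GalT.ext_of_apply σ₀ h)
      · exact Or.inr (GalT.ext_of_apply σ₀ (by simpa using h))
    · rintro (rfl | rfl)
      · exact Or.inl rfl
      · exact Or.inr (by simp)
  rw [hplace]

omit [IsGalois ℚ F] in
/-- Abstract flips at two Galois translates commute. -/
theorem oflipCM_comm (t t' : GalT F) (Ψ : CMF (GalT F) conjT) :
    oflipCM conjT conjT_mul_self t (oflipCM conjT conjT_mul_self t' Ψ) =
      oflipCM conjT conjT_mul_self t' (oflipCM conjT conjT_mul_self t Ψ) := by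
  apply Subtype.ext
  change (Ψ.1 ∆ orb conjT t') ∆ orb conjT t = (Ψ.1 ∆ orb conjT t) ∆ orb conjT t'
  rw [symmDiff_assoc, symmDiff_assoc, symmDiff_comm (orb conjT t')]

omit [IsGalois ℚ F] in
/-- Abstract flip commutes with conjugation of abstract CM types. -/
theorem oflipCM_barCM (t : GalT F) (Ψ : CMF (GalT F) conjT) :
    oflipCM conjT conjT_mul_self t (barCM Ψ) = barCM (oflipCM conjT conjT_mul_self t Ψ) := by
  apply Subtype.ext
  ext x
  change x ∈ (barCM Ψ).1 ∆ orb conjT t ↔ x ∈ (barCM (oflipCM conjT conjT_mul_self t Ψ)).1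
  rw [mem_barCM, Finset.mem_symmDiff, mem_barCM]
  change _ ↔ x ∉ Ψ.1 ∆ orb conjT t
  rw [Finset.mem_symmDiff]
  tauto

/-- The geometric face attached to a group-level face datum `(Φ'; t, t')` and a base point `σ₀`. -/
def faceOfG (σ₀ : F →+* ℂ) (Φ' : CMF (GalT F) conjT) (t t' : GalT F) (ht' : t' ∉ orb conjT t) : Face F where
  Φ := pushType σ₀ Φ'
  p := t.1 σ₀
  p' := t'.1 σ₀
  place_ne := by
    intro h
    rw [InfinitePlace.mk_eq_iff] at h
    apply ht'
    rw [mem_orb]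
    rcases h with h | h
    · exact Or.inl (GalT.ext_of_apply σ₀ h).symm
    · refine Or.inr (GalT.ext_of_apply σ₀ ?_)
      simpa using h.symm

/-- **Dictionary**: the Lefschetz character of the `σ₀`-Weil weight on the corners
`(Φ, Φ̄^{(π)}, Φ̄^{(π′)}, Φ^{(ππ′)})` of the face is `ā` of the face relation
`[Φ] + [Φ^{(ππ′)}] − [Φ^{(π)}] − [Φ^{(π′)}]` (the two conjugated corners contribute with a MINUS sign:
"ā kills pairs" = the ā-bridge of [QW8] §3 at the combinatorial level). -/
theorem lefChar_corner_faceOfG (σ₀ : F →+* ℂ) (Φ' : CMF (GalT F) conjT) (t t' : GalT F)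
    (ht' : t' ∉ orb conjT t) :
    lefChar (faceOfG σ₀ Φ' t t' ht').corner (fun _ => {σ₀}) =
      abar (gface conjT conjT_mul_self Φ' t t') := by
  unfold lefChar
  rw [Fin.sum_univ_four]
  simp only [Finset.sum_singleton]
  change achar (pullType (pushType σ₀ Φ') σ₀) +
      achar (pullType (flip (t.1 σ₀) (bar (pushType σ₀ Φ'))) σ₀) +
      achar (pullType (flip (t'.1 σ₀) (bar (pushType σ₀ Φ'))) σ₀) +
      achar (pullType (flip (t'.1 σ₀) (flip (t.1 σ₀) (pushType σ₀ Φ'))) σ₀) = _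
  simp only [pullType_flip, pullType_bar, pullType_pushType, oflipCM_barCM, achar_bar]
  rw [oflipCM_comm t' t, gface, map_sub, map_sub, map_add]
  simp only [achar]
  abel

/-- **Main combinatorial theorem** (COR-CM (a)+(b4)+row 9, all `g`): for a Galois CM field `F` and a
Hodge weight `S` on `∏_j A_{(F,Θ_j)}`, the Lefschetz character `a(e_S)` is an integer combination of
the Lefschetz characters of `σ₀`-Weil weights on corner products of rank-four faces of `F`. -/
theorem lefChar_eq_sum_faces [IsTotallyComplex F] {n : ℕ} (Θ : Fin (n + 1) → CMType F) {p : ℕ}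
    (S : Fin (n + 1) → Finset (F →+* ℂ)) (hS : IsHodgeWeight Θ p S) (σ₀ : F →+* ℂ) :
    ∃ (m : ℕ) (f : Fin m → Face F) (c : Fin m → ℤ),
      lefChar Θ S = ∑ i, c i • lefChar (f i).corner (fun _ => {σ₀}) := by
  obtain ⟨m, c, y, h⟩ := lefChar_eq_sum_gface Θ S hS
  have hy : ∀ i, ∃ (Φ' : CMF (GalT F) conjT) (t t' : GalT F) (ht' : t' ∉ orb conjT t),
      (y i).1 = gface conjT conjT_mul_self Φ' t t' := by
    intro i
    obtain ⟨Φ', t, t', ht', e⟩ := (y i).2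
    exact ⟨Φ', t, t', ht', e⟩
  choose Φ' t t' ht' hy using hy
  refine ⟨m, fun i => faceOfG σ₀ (Φ' i) (t i) (t' i) (ht' i), c, ?_⟩
  rw [h]
  refine Finset.sum_congr rfl fun i _ => ?_
  rw [lefChar_corner_faceOfG, hy]

end Main

end Summit.HodgeConjecture.CorCM

end
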